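import Summits.QuantumFields.BalabanUV.T4Continuum.Support.NE3CovariantTentInterpolant
import Summits.QuantumFields.BalabanUV.T4Continuum.Support.NE3CovariantVertexDefect
import Summits.QuantumFields.BalabanUV.T4Continuum.Support.NE3BlockMeanExactLocal
import HarnessLib

/-!
# T⁴ programme, node NE3 — row E-MLw-(w4)-P-curved, route H♮, row K5c (file 4): THE INTERPOLATION–MEAN DEFECT OF THE COVARIANT
# TENT INTERPOLANT — `‖m z − bmeanW M W (tinterpW M W m) z‖` against covariant cube differences and transport defects

NE3 (node U1b) formalisation swarm, leaf seat `b2b-balaban-t4-ne3-formalise-leaf-01` (gen 6); row **K5** of ruling ρ-g22-2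
(`HOME/t4/b2b-balaban-t4-ne3-p1/g22/D-ne3p1-g22-1.md` §2 S7), sub-row **K5c** (FINDING F-ne3leaf01g6-1 ∕ INTENT, `HOME/CLAIMS.log`
2026-08-20 ≈18:08Z ∕ ≈18:15Z).  The mean-corrected competitor (`NE3CovariantTentInterpolantMean`) carries a dressed bump of coefficient
`8^d·‖b z − bmeanW (tinterpW m) z‖`; this file bounds the interpolation part `‖m z − bmeanW M W (tinterpW M W m) z‖`.  Over file 1
(`tinterpW`, `vtxW`, `Ad_interp`), the kit `NE3CovariantVertexDefect` (`norm_vertexDefect_le`, cell geometry), the lineage's K5b-2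
`NE3CoarseFrameData` (`norm_dPot_frameData_cube_le`) and K5b-3a `NE3BlockMeanExactLocal` (`cubeEnergy`, `normSq_vertex_sub_le_cube`) BY NAME.

CONTENT ([folklore]; 0 sorry; 0 def), `[Nonempty n]`, `M ≥ 1`, `W`, `U` unitary, `SmallField W a`, `SmallField U a_U`, `0 ≤ a, a_U, δ`,
`‖U − bseg M W‖ ≤ δ` bondwise:
§1 `cubeEnergy_frameData_le` — `cubeEnergy (frameData U m z) z ≤ 2·Σ_{S,i} ‖gaugeDir U m (z + indic S) i‖² + 8d·((d−1)a_U)²·Σ_S ‖m (z + indic S)‖²`;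
§2 `normSq_vertexTerm_le` (one cube vertex through one block site; loop `≤ 3dM`, chain `≤ d`), `normSq_offsetDefect_le` (one block site:
   local convexity over the `2^d` vertex terms), and **`normSq_sub_bmeanW_tinterpW_le`** (Jensen over the block):
   `‖m z − bmeanW M W (tinterpW M W m) z‖² ≤ 2^{2d+2}·d·Σ_{S ⊆ univ} Σ_i ‖gaugeDir U m (z + indic S) i‖²
      + (2^{2d+4}·d²·(d−1)²·a_U² + 8·(9d²M²a + dδ)²)·Σ_{T ⊆ univ} ‖m (z + indic T)‖²`
   — covariant differences on the unit cube plus `(a_U² + (M²a)² + δ²)`-sized data defects: with file 3's dressed-bump energy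
   `M^{d−2}·C·Σ_z‖c z‖²` this is again the S7 shape.

HONEST FRAMING.  Kinematics of OUR competitor at one background in the small-field class; nothing about Bałaban's minimisers;
(P♮)_W ∕ (ML_w) at W ≠ 1, T-E_w and **NE3 are NOT proved**; spine PROVED 0∕9; finite T⁴ rung (B)+1 — NOT infinite volume, NOT
mass gap, NOT `BetaPertH`, NOT Clay.  PLACEMENT: `Summits/QuantumFields/BalabanUV/`.  HONEST DEPENDENCY (cell page 1): continuum YM
on T⁴ ⇐ BetaPertH ∧ nine spine estimates (0/9 proved); BetaPertH ⇐ (D1) ∧ (D4) ∧ CAP+tail; G-an2-4 gates asym, D1 and NE2/3/4.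
-/

set_option autoImplicit false

open scoped BigOperators Matrix.Norms.L2Operator
open Finset

namespace Summit.QuantumFields.BalabanUV.T4Continuum.NE3CovariantTentInterpolantMeanDefect

open Literature.MathematicalPhysics.QuantumFieldTheory.Balaban1983to89
open B7Prop1Explicit B7Prop2Explicit
open T4AveragingDeficitWall (IsUnitaryCfg SmallField Ad)
open T4AveragingDeficitWallBoundary (periodBox mem_periodBox card_periodBox)
open T4AveragingDeficitNonAbelian (Ad_mul Ad_sub)
open AveragingDeficitTransport (norm_Ad_of_unitary)
open AveragingDeficitBlockDensity (btree bseg btree_mem card_offsets_real)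
open BlockAveragePushDirGauge (gaugeDir)
open SmoothRefineBlocks (blk)
open SmoothRefineInterp (indic indic_apply interpCore_const interp interp_sub)
open NE3CoarseInterpolant (normSq_interp_le blk_block)
open NE3TangentNoGoWords (dPot)
open NE3CovariantBlockMean (bmeanW)
open NE3CoarseFrameData (frameData frameData_self norm_dPot_frameData_cube_le)
open NE3BlockMeanExactLocal (cubeEnergy cubeEnergy_nonneg normSq_vertex_sub_le_cube)
open NE3BlockMeanExactInterpolant (normSq_sum_le_card_mul)
open NE3CovariantTentInterpolant (vtxW tinterpW Ad_interp)
open NE3CovariantVertexDefect (norm_vertexDefect_le l1_le_of_abs_le' abs_block_sub_vertex_le abs_block_sub_corner_le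
  abs_vertex_sub_corner_le abs_indic_le)

noncomputable section

variable {d : ℕ} {n : Type*} [Fintype n] [DecidableEq n]

/-! ## §1 The cube energy of the frame datum -/

/-- The cube energy of the frame datum against the covariant cube differences (`U` unitary, `SmallField U a_U`, `0 ≤ a_U`):
`cubeEnergy (frameData U m z) z ≤ 2·Σ_{S,i} ‖gaugeDir U m (z + indic S) i‖² + 8·d·(d−1)²·a_U²·Σ_S ‖m (z + indic S)‖²`. [folklore] -/
theorem cubeEnergy_frameData_le [Nonempty n] {U : Site d → Fin d → (Matrix n n ℂ)ˣ} (hU : IsUnitaryCfg U) {aU : ℝ} (haU : 0 ≤ aU)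
    (hUa : SmallField U aU) (m : Site d → Matrix n n ℂ) (z : Site d) :
    cubeEnergy (frameData U m z) z
      ≤ 2 * ∑ S ∈ (Finset.univ : Finset (Fin d)).powerset, ∑ i : Fin d, ‖gaugeDir U m (z + indic S) i‖ ^ 2
        + 8 * (d : ℝ) * (((d : ℝ) - 1) * aU) ^ 2 * ∑ S ∈ (Finset.univ : Finset (Fin d)).powerset, ‖m (z + indic S)‖ ^ 2 := by
  unfold cubeEnergy
  have hpt : ∀ (S : Finset (Fin d)) (i : Fin d), ‖dPot (frameData U m z) (z + indic S) i‖ ^ 2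
      ≤ 2 * ‖gaugeDir U m (z + indic S) i‖ ^ 2 + 8 * (((d : ℝ) - 1) * aU) ^ 2 * ‖m (z + indic S)‖ ^ 2 := by
    intro S i
    have hz1 : z ≤ z + indic S := by
      intro j; simp only [Pi.add_apply, indic_apply]; split_ifs <;> simp
    have hz2 : z + indic S ≤ z + fun _ => (1 : ℤ) := by
      intro j; simp only [Pi.add_apply, indic_apply]; split_ifs <;> simp
    have h := norm_dPot_frameData_cube_le hU haU hUa m hz1 hz2 i
    have h0 : 0 ≤ 2 * (((d : ℝ) - 1) * aU) * ‖m (z + indic S)‖ := by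
      have : 0 ≤ ((d : ℝ) - 1) := by
        have : (1 : ℝ) ≤ d := by exact_mod_cast Fin.pos i
        linarith
      positivity
    calc ‖dPot (frameData U m z) (z + indic S) i‖ ^ 2
        ≤ (‖gaugeDir U m (z + indic S) i‖ + 2 * (((d : ℝ) - 1) * aU) * ‖m (z + indic S)‖) ^ 2 :=
          pow_le_pow_left₀ (norm_nonneg _) h 2
      _ ≤ _ := by nlinarith [sq_nonneg (‖gaugeDir U m (z + indic S) i‖ - 2 * (((d : ℝ) - 1) * aU) * ‖m (z + indic S)‖)]
  calc ∑ S ∈ (Finset.univ : Finset (Fin d)).powerset, ∑ i : Fin d, ‖dPot (frameData U m z) (z + indic S) i‖ ^ 2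
      ≤ ∑ S ∈ (Finset.univ : Finset (Fin d)).powerset, ∑ i : Fin d,
          (2 * ‖gaugeDir U m (z + indic S) i‖ ^ 2 + 8 * (((d : ℝ) - 1) * aU) ^ 2 * ‖m (z + indic S)‖ ^ 2) :=
        Finset.sum_le_sum fun S _ => Finset.sum_le_sum fun i _ => hpt S i
    _ = _ := by
        simp only [Finset.sum_add_distrib, Finset.mul_sum, Finset.sum_const, Finset.card_univ, Fintype.card_fin, nsmul_eq_mul]
        ring

/-! ## §2 Vertex terms, block sites, and the block (Jensen) -/

section Block

variable [Nonempty n]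

/-- ONE CUBE VERTEX, read in the corner frame through the block site `M•z + v` (`W`, `U` unitary; `SmallField W a`, `0 ≤ a, δ`;
`‖U − bseg M W‖ ≤ δ` bondwise):
`‖m z − Ad_{btree_z(y)·btree_{z+1_T}(y)⁻¹}(m (z + 1_T))‖² ≤ 2·(2^d·d·cubeEnergy (frameData U m z) z) + 8·(9d²M²a + dδ)²·‖m (z + 1_T)‖²`. [folklore] -/
theorem normSq_vertexTerm_le {M : ℕ} {W U : Site d → Fin d → (Matrix n n ℂ)ˣ} (hW : IsUnitaryCfg W) (hU : IsUnitaryCfg U)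
    {a δ : ℝ} (ha : 0 ≤ a) (hδ0 : 0 ≤ δ) (hWa : SmallField W a)
    (hδ : ∀ (x : Site d) (α : Fin d), ‖((U x α : (Matrix n n ℂ)ˣ) : Matrix n n ℂ) - bseg M W x α‖ ≤ δ)
    (m : Site d → Matrix n n ℂ) (z : Site d) {v : Site d} (hv : v ∈ periodBox (d := d) M) (T : Finset (Fin d)) :
    ‖m z - Ad (btree M W z ((M : ℤ) • z + v) * (btree M W (z + indic T) ((M : ℤ) • z + v))⁻¹) (m (z + indic T))‖ ^ 2
      ≤ 2 * ((2 : ℝ) ^ d * d * cubeEnergy (frameData U m z) z)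
        + 8 * (9 * (d : ℝ) ^ 2 * (M : ℝ) ^ 2 * a + (d : ℝ) * δ) ^ 2 * ‖m (z + indic T)‖ ^ 2 := by
  have hzw : z ≤ z + indic T := by
    intro j; simp only [Pi.add_apply, indic_apply]; split_ifs <;> simp
  have h1 := norm_vertexDefect_le (M := M) hW hU ha hWa hδ m ((M : ℤ) • z + v) hzw
  -- the loop is at most `3dM` long, the chain at most `d`
  have hl1 : l1 ((M : ℤ) • z + v - (M : ℤ) • (z + indic T)) ≤ d * M := l1_le_of_abs_le' fun j => abs_block_sub_vertex_le z hv T j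
  have hl2 : l1 ((M : ℤ) • z + v - (M : ℤ) • z) ≤ d * M := l1_le_of_abs_le' fun j => abs_block_sub_corner_le z hv j
  have hl3 : l1 ((M : ℤ) • (z + indic T) - (M : ℤ) • z) ≤ d * M := l1_le_of_abs_le' fun j => abs_vertex_sub_corner_le M z T j
  have hlT : l1 (z + indic T - z) ≤ d * 1 := l1_le_of_abs_le' fun j => abs_indic_le z T j
  have hℓ : (((l1 ((M : ℤ) • z + v - (M : ℤ) • (z + indic T)) + l1 ((M : ℤ) • z + v - (M : ℤ) • z)
      + l1 ((M : ℤ) • (z + indic T) - (M : ℤ) • z) : ℕ) : ℝ)) ≤ 3 * (d : ℝ) * M := by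
    have h3 : l1 ((M : ℤ) • z + v - (M : ℤ) • (z + indic T)) + l1 ((M : ℤ) • z + v - (M : ℤ) • z)
        + l1 ((M : ℤ) • (z + indic T) - (M : ℤ) • z) ≤ d * M + d * M + d * M := by omega
    have h4 : ((d * M + d * M + d * M : ℕ) : ℝ) = 3 * (d : ℝ) * M := by push_cast; ring
    exact le_trans (by exact_mod_cast h3) h4.le
  have hlT' : (l1 (z + indic T - z) : ℝ) ≤ d := by exact_mod_cast (hlT.trans (le_of_eq (mul_one d)))
  have hq : (((l1 ((M : ℤ) • z + v - (M : ℤ) • (z + indic T)) + l1 ((M : ℤ) • z + v - (M : ℤ) • z)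
      + l1 ((M : ℤ) • (z + indic T) - (M : ℤ) • z) : ℕ) : ℝ)) ^ 2 * a + (l1 (z + indic T - z) : ℝ) * δ
        ≤ 9 * (d : ℝ) ^ 2 * (M : ℝ) ^ 2 * a + (d : ℝ) * δ := by
    have h0 : (0 : ℝ) ≤ (((l1 ((M : ℤ) • z + v - (M : ℤ) • (z + indic T)) + l1 ((M : ℤ) • z + v - (M : ℤ) • z)
      + l1 ((M : ℤ) • (z + indic T) - (M : ℤ) • z) : ℕ) : ℝ)) := Nat.cast_nonneg _
    have hsq := mul_le_mul_of_nonneg_right (pow_le_pow_left₀ h0 hℓ 2) ha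
    have hch := mul_le_mul_of_nonneg_right hlT' hδ0
    have e9 : (3 * (d : ℝ) * M) ^ 2 * a = 9 * (d : ℝ) ^ 2 * (M : ℝ) ^ 2 * a := by ring
    linarith
  have hfd : ‖frameData U m z (z + indic T) - m z‖ ^ 2 ≤ (2 : ℝ) ^ d * d * cubeEnergy (frameData U m z) z := by
    have h := normSq_vertex_sub_le_cube (frameData U m z) z T
    rwa [frameData_self] at h
  have hQ0 : 0 ≤ 9 * (d : ℝ) ^ 2 * (M : ℝ) ^ 2 * a + (d : ℝ) * δ := by positivity
  have hE : ‖m z - Ad (btree M W z ((M : ℤ) • z + v) * (btree M W (z + indic T) ((M : ℤ) • z + v))⁻¹) (m (z + indic T))‖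
      ≤ ‖frameData U m z (z + indic T) - m z‖ + 2 * (9 * (d : ℝ) ^ 2 * (M : ℝ) ^ 2 * a + (d : ℝ) * δ) * ‖m (z + indic T)‖ := by
    refine h1.trans (add_le_add le_rfl ?_)
    exact mul_le_mul_of_nonneg_right (mul_le_mul_of_nonneg_left hq (by norm_num)) (norm_nonneg _)
  have hp0 := norm_nonneg (frameData U m z (z + indic T) - m z)
  have hm0 := norm_nonneg (m (z + indic T))
  calc ‖m z - Ad (btree M W z ((M : ℤ) • z + v) * (btree M W (z + indic T) ((M : ℤ) • z + v))⁻¹) (m (z + indic T))‖ ^ 2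
      ≤ (‖frameData U m z (z + indic T) - m z‖ + 2 * (9 * (d : ℝ) ^ 2 * (M : ℝ) ^ 2 * a + (d : ℝ) * δ) * ‖m (z + indic T)‖) ^ 2 :=
        pow_le_pow_left₀ (norm_nonneg _) hE 2
    _ ≤ 2 * ‖frameData U m z (z + indic T) - m z‖ ^ 2
          + 2 * (2 * (9 * (d : ℝ) ^ 2 * (M : ℝ) ^ 2 * a + (d : ℝ) * δ) * ‖m (z + indic T)‖) ^ 2 := by
        nlinarith [sq_nonneg (‖frameData U m z (z + indic T) - m z‖
          - 2 * (9 * (d : ℝ) ^ 2 * (M : ℝ) ^ 2 * a + (d : ℝ) * δ) * ‖m (z + indic T)‖)]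
    _ ≤ _ := by nlinarith [hfd]

/-- THE DEFECT AT ONE BLOCK SITE: `‖m z − Ad_{btree_z(M•z+v)}(tinterpW M W m (M•z+v))‖²` against the cube data (`M ≥ 1`). [folklore] -/
theorem normSq_offsetDefect_le {M : ℕ} (hM : 1 ≤ M) {W U : Site d → Fin d → (Matrix n n ℂ)ˣ} (hW : IsUnitaryCfg W)
    (hU : IsUnitaryCfg U) {a aU δ : ℝ} (ha : 0 ≤ a) (haU : 0 ≤ aU) (hδ0 : 0 ≤ δ) (hWa : SmallField W a) (hUa : SmallField U aU)
    (hδ : ∀ (x : Site d) (α : Fin d), ‖((U x α : (Matrix n n ℂ)ˣ) : Matrix n n ℂ) - bseg M W x α‖ ≤ δ)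
    (m : Site d → Matrix n n ℂ) (z : Site d) {v : Site d} (hv : v ∈ periodBox (d := d) M) :
    ‖m z - Ad (btree M W z ((M : ℤ) • z + v)) (tinterpW M W m ((M : ℤ) • z + v))‖ ^ 2
      ≤ (2 : ℝ) ^ (2 * d + 2) * d * ∑ S ∈ (Finset.univ : Finset (Fin d)).powerset, ∑ i : Fin d, ‖gaugeDir U m (z + indic S) i‖ ^ 2
        + ((2 : ℝ) ^ (2 * d + 4) * (d : ℝ) ^ 2 * ((d : ℝ) - 1) ^ 2 * aU ^ 2
            + 8 * (9 * (d : ℝ) ^ 2 * (M : ℝ) ^ 2 * a + (d : ℝ) * δ) ^ 2)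
          * ∑ T ∈ (Finset.univ : Finset (Fin d)).powerset, ‖m (z + indic T)‖ ^ 2 := by
  have hblk : blk M ((M : ℤ) • z + v) = z := blk_block hM z hv
  have hpow : (((Finset.univ : Finset (Fin d)).powerset.card : ℝ)) = (2 : ℝ) ^ d := by
    rw [Finset.card_powerset, Finset.card_univ, Fintype.card_fin]; push_cast; ring
  have hcube := cubeEnergy_frameData_le hU haU hUa m z
  -- the defect as an interpolant of vertex terms
  have hI : m z - Ad (btree M W z ((M : ℤ) • z + v)) (tinterpW M W m ((M : ℤ) • z + v))
      = interp M Finset.univ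
          (fun w => m z - Ad (btree M W z ((M : ℤ) • z + v) * (btree M W w ((M : ℤ) • z + v))⁻¹) (m w)) ((M : ℤ) • z + v) := by
    rw [interp_sub]
    unfold tinterpW
    rw [Ad_interp]
    congr 1
    · unfold interp; rw [interpCore_const]
    · congr 1; funext w; rw [vtxW, Ad_mul]
  rw [hI]
  refine (normSq_interp_le hM _ _ _).trans ?_
  rw [hblk]
  calc ∑ T ∈ (Finset.univ : Finset (Fin d)).powerset,
        ‖m z - Ad (btree M W z ((M : ℤ) • z + v) * (btree M W (z + indic T) ((M : ℤ) • z + v))⁻¹) (m (z + indic T))‖ ^ 2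
      ≤ ∑ T ∈ (Finset.univ : Finset (Fin d)).powerset, (2 * ((2 : ℝ) ^ d * d * cubeEnergy (frameData U m z) z)
          + 8 * (9 * (d : ℝ) ^ 2 * (M : ℝ) ^ 2 * a + (d : ℝ) * δ) ^ 2 * ‖m (z + indic T)‖ ^ 2) :=
        Finset.sum_le_sum fun T _ => normSq_vertexTerm_le hW hU ha hδ0 hWa hδ m z hv T
    _ = (2 : ℝ) ^ d * (2 * ((2 : ℝ) ^ d * d * cubeEnergy (frameData U m z) z))
          + 8 * (9 * (d : ℝ) ^ 2 * (M : ℝ) ^ 2 * a + (d : ℝ) * δ) ^ 2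
            * ∑ T ∈ (Finset.univ : Finset (Fin d)).powerset, ‖m (z + indic T)‖ ^ 2 := by
        rw [Finset.sum_add_distrib, Finset.sum_const, nsmul_eq_mul, hpow, ← Finset.mul_sum]
    _ ≤ (2 : ℝ) ^ d * (2 * ((2 : ℝ) ^ d * d
          * (2 * ∑ S ∈ (Finset.univ : Finset (Fin d)).powerset, ∑ i : Fin d, ‖gaugeDir U m (z + indic S) i‖ ^ 2
            + 8 * (d : ℝ) * (((d : ℝ) - 1) * aU) ^ 2 * ∑ S ∈ (Finset.univ : Finset (Fin d)).powerset, ‖m (z + indic S)‖ ^ 2)))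
          + 8 * (9 * (d : ℝ) ^ 2 * (M : ℝ) ^ 2 * a + (d : ℝ) * δ) ^ 2
            * ∑ T ∈ (Finset.univ : Finset (Fin d)).powerset, ‖m (z + indic T)‖ ^ 2 := by
        gcongr
    _ = _ := by ring

/-- **THE INTERPOLATION–MEAN DEFECT OF ONE BLOCK** (`M ≥ 1`; `W`, `U` unitary; `SmallField W a`, `SmallField U a_U`, `0 ≤ a, a_U, δ`;
`‖U − bseg M W‖ ≤ δ` bondwise):
`‖m z − bmeanW M W (tinterpW M W m) z‖² ≤ 2^{2d+2}·d·Σ_{S ⊆ univ} Σ_i ‖gaugeDir U m (z + indic S) i‖²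
   + (2^{2d+4}·d²·(d−1)²·a_U² + 8·(9d²M²a + dδ)²)·Σ_{T ⊆ univ} ‖m (z + indic T)‖²`. [folklore] -/
theorem normSq_sub_bmeanW_tinterpW_le {M : ℕ} (hM : 1 ≤ M) {W U : Site d → Fin d → (Matrix n n ℂ)ˣ} (hW : IsUnitaryCfg W)
    (hU : IsUnitaryCfg U) {a aU δ : ℝ} (ha : 0 ≤ a) (haU : 0 ≤ aU) (hδ0 : 0 ≤ δ) (hWa : SmallField W a) (hUa : SmallField U aU)
    (hδ : ∀ (x : Site d) (α : Fin d), ‖((U x α : (Matrix n n ℂ)ˣ) : Matrix n n ℂ) - bseg M W x α‖ ≤ δ)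
    (m : Site d → Matrix n n ℂ) (z : Site d) :
    ‖m z - bmeanW M W (tinterpW M W m) z‖ ^ 2
      ≤ (2 : ℝ) ^ (2 * d + 2) * d * ∑ S ∈ (Finset.univ : Finset (Fin d)).powerset, ∑ i : Fin d, ‖gaugeDir U m (z + indic S) i‖ ^ 2
        + ((2 : ℝ) ^ (2 * d + 4) * (d : ℝ) ^ 2 * ((d : ℝ) - 1) ^ 2 * aU ^ 2
            + 8 * (9 * (d : ℝ) ^ 2 * (M : ℝ) ^ 2 * a + (d : ℝ) * δ) ^ 2)
          * ∑ T ∈ (Finset.univ : Finset (Fin d)).powerset, ‖m (z + indic T)‖ ^ 2 := by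
  have hM0 : (0 : ℝ) < M := by exact_mod_cast (by omega : 0 < M)
  -- the per-offset bound
  have hX := fun (v : Site d) (hv : v ∈ periodBox (d := d) M) =>
    normSq_offsetDefect_le hM hW hU ha haU hδ0 hWa hUa hδ m z hv
  -- the defect is the block average of the offset defects
  have hcard : ((Finset.univ : Finset (Fin d → Fin M)).card : ℝ) = (M : ℝ) ^ d := card_offsets_real M
  have hbm : bmeanW M W (tinterpW M W m) z
      = ∑ r : Fin d → Fin M, (((M : ℝ) ^ d)⁻¹ : ℝ)
          • Ad (btree M W z ((M : ℤ) • z + boxVec M r)) (tinterpW M W m ((M : ℤ) • z + boxVec M r)) := by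
    unfold bmeanW
    refine Finset.sum_congr rfl fun r _ => ?_
    rw [btree, add_sub_cancel_left]
  have hmz : m z = ∑ _r : Fin d → Fin M, (((M : ℝ) ^ d)⁻¹ : ℝ) • m z := by
    rw [Finset.sum_const, ← Nat.cast_smul_eq_nsmul ℝ, hcard, smul_smul, mul_inv_cancel₀ (by positivity), one_smul]
  have hrepr : m z - bmeanW M W (tinterpW M W m) z
      = ∑ r : Fin d → Fin M, (((M : ℝ) ^ d)⁻¹ : ℝ)
          • (m z - Ad (btree M W z ((M : ℤ) • z + boxVec M r)) (tinterpW M W m ((M : ℤ) • z + boxVec M r))) := by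
    have h : m z - bmeanW M W (tinterpW M W m) z
        = (∑ _r : Fin d → Fin M, (((M : ℝ) ^ d)⁻¹ : ℝ) • m z)
          - ∑ r : Fin d → Fin M, (((M : ℝ) ^ d)⁻¹ : ℝ)
              • Ad (btree M W z ((M : ℤ) • z + boxVec M r)) (tinterpW M W m ((M : ℤ) • z + boxVec M r)) := by
      rw [← hmz, hbm]
    rw [h, ← Finset.sum_sub_distrib]
    refine Finset.sum_congr rfl fun r _ => ?_
    rw [smul_sub]
  rw [hrepr]
  refine (normSq_sum_le_card_mul _ _).trans ?_
  rw [hcard]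
  calc (M : ℝ) ^ d * ∑ r : Fin d → Fin M, ‖(((M : ℝ) ^ d)⁻¹ : ℝ)
          • (m z - Ad (btree M W z ((M : ℤ) • z + boxVec M r)) (tinterpW M W m ((M : ℤ) • z + boxVec M r)))‖ ^ 2
      ≤ (M : ℝ) ^ d * ∑ _r : Fin d → Fin M, (((M : ℝ) ^ d)⁻¹) ^ 2
          * ((2 : ℝ) ^ (2 * d + 2) * d * ∑ S ∈ (Finset.univ : Finset (Fin d)).powerset, ∑ i : Fin d, ‖gaugeDir U m (z + indic S) i‖ ^ 2
            + ((2 : ℝ) ^ (2 * d + 4) * (d : ℝ) ^ 2 * ((d : ℝ) - 1) ^ 2 * aU ^ 2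
                + 8 * (9 * (d : ℝ) ^ 2 * (M : ℝ) ^ 2 * a + (d : ℝ) * δ) ^ 2)
              * ∑ T ∈ (Finset.univ : Finset (Fin d)).powerset, ‖m (z + indic T)‖ ^ 2) := by
        gcongr with r _
        rw [norm_smul, mul_pow, Real.norm_of_nonneg (by positivity)]
        exact mul_le_mul_of_nonneg_left (hX (boxVec M r) (Finset.mem_image_of_mem _ (Finset.mem_univ r))) (by positivity)
    _ = _ := by
        rw [Finset.sum_const, nsmul_eq_mul, hcard]
        field_simp

end Block

end

end Summit.QuantumFields.BalabanUV.T4Continuum.NE3CovariantTentInterpolantMeanDefect
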